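import Summits.AtomisticToContinuum.Crystallization.Theorems.FrustratedLawDichotomyBumpRadialCertFar
import Mathlib.Analysis.Convex.Mul

/-!
# FrustratedLawDichotomy · the Lennard-Jones TAIL of the radial certificate made explicit: `SF₄₅` / `SF₅` from a NEAR-FIELD certificate alone

`…BumpRadialCertFar.sf₄₅_of_radialCert_finite` (hand-1 g13) asks, beyond the near-field inequality on a compact range, for a far-field
pointwise inequality `−(V·w)(r) ≤ (32πa³/105)²·κ(r)` and the convexity of `s·κ(s)` on `[R₁ − 2a, ∞)`.  Both are discharged OUTRIGHT here for
the natural tail `κ(s) = s⁻⁶/(6M)`, `M = (32πa³/105)²`, beyond `R₁ − 2a`: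

* §1 the clipped smoothsteps take values in `[0, 1]` (`smoothstep₁_mem_Icc`, `smoothstep₂_mem_Icc`), hence `w₄₅ r, w₅ r ∈ [0, 1]`;
  `w₄₅ r = 0` for `r ≤ 3`;
* §2 `neg_tailPot_le`: `0 ≤ w(r) ≤ 1`, `r > 0` ⟹ `−(V·w)(r) ≤ r⁻⁶/6` (`V = r⁻¹²/12 − r⁻⁶/6`, Blanc–Lewin normalisation of the tree);
* §3 `radialCert_nonneg`: the certificate functional is `≥ 0` for `κ ≥ 0` (so below `r = 3`, where `w = 0`, nothing is to be checked);
* §4 `convexOn_tail`: `s ↦ s·κ(s) = s⁻⁵/(6M)` is convex on `[s₀, ∞)`, `s₀ > 0` (`convexOn_zpow (−5)`);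
* §5 ★★ `sf₄₅_of_nearCert` (`a = 4/5`, `A = 3/400`): a continuous `κ ≥ 0` with `s²κ` integrable on `(0,∞)`, EQUAL to `s⁻⁶/(6M)` on
  `[R₁ − 8/5, ∞)` (`R₁ > 8/5`), the near-field inequality for `3 < r ≤ R₁` ONLY, and the budget `4π(∫ s²κ)·(4/5)³·256π/3465 ≤ 3/400`
  ⟹ `SF₄₅`; ★ `sf₅_of_nearCert` likewise (`a = 1`, `A = 13/4000`, tail from `R₁ − 2`, `R₁ > 2`).

So census's TAG 181-S(i) object for the Schur floor of record is now EXACTLY: values of `κ` on the compact range `[0, R₁ − 8/5]` (continuous,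
`≥ 0`, matching the tail at the junction), ONE one-variable inequality on `r ∈ (3, R₁]`, ONE number (the budget).  DEF-FREE; [folklore]; 0 sorry.
Prover hand 1, gen 13 (decomp-a2c), `--supports stmt-AtomisticToContinuum-27623`.
-/

noncomputable section

namespace Summit.AtomisticToContinuum.Crystallization.Theorems.FrustratedLawDichotomyBumpAutocorrelation

open MeasureTheory Set Real
open scoped BigOperators
open Literature.MathematicalPhysics.StatisticalMechanics (lennardJones)
open Summit.AtomisticToContinuum.Crystallization.Theorems.FrustratedLawDichotomySchurCut
  (omega₂ omega₂_zero omega₂_of_two_le SchurFloor tailPot SF₄₅ SF₅ w₄₅ w₅ ω₄ ω₅ cutWeight smoothstep₁ smoothstep₂ w₅_eq_zero)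

/-! ## §1. The tail weights take values in `[0, 1]` -/

/-- `smoothstep₁ x ∈ [0, 1]`. [folklore] -/
theorem smoothstep₁_mem_Icc (x : ℝ) : smoothstep₁ x ∈ Icc (0:ℝ) 1 := by
  unfold smoothstep₁
  split_ifs with h1 h2
  · exact ⟨le_rfl, zero_le_one⟩
  · exact ⟨zero_le_one, le_rfl⟩
  · push Not at h1 h2
    constructor
    · nlinarith [mul_nonneg (sq_nonneg x) (by linarith : (0:ℝ) ≤ 3 - 2 * x)]
    · nlinarith [mul_nonneg (sq_nonneg (1 - x)) (by linarith : (0:ℝ) ≤ 1 + 2 * x)]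

/-- `smoothstep₂ x ∈ [0, 1]`. [folklore] -/
theorem smoothstep₂_mem_Icc (x : ℝ) : smoothstep₂ x ∈ Icc (0:ℝ) 1 := by
  unfold smoothstep₂
  split_ifs with h1 h2
  · exact ⟨le_rfl, zero_le_one⟩
  · exact ⟨zero_le_one, le_rfl⟩
  · push Not at h1 h2
    have hq : 0 ≤ 10 - 15 * x + 6 * x ^ 2 := by nlinarith [sq_nonneg (x - 5 / 4)]
    constructor
    · nlinarith [mul_nonneg (pow_nonneg h1.le 3) hq]
    · have hq' : 0 ≤ 1 + 3 * x + 6 * x ^ 2 := by nlinarith [sq_nonneg x]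
      nlinarith [mul_nonneg (pow_nonneg (by linarith : (0:ℝ) ≤ 1 - x) 3) hq']

/-- `w₄₅ r ∈ [0, 1]`. [folklore] -/
theorem w₄₅_mem_Icc (r : ℝ) : w₄₅ r ∈ Icc (0:ℝ) 1 := smoothstep₁_mem_Icc _

/-- `w₅ r ∈ [0, 1]`. [folklore] -/
theorem w₅_mem_Icc (r : ℝ) : w₅ r ∈ Icc (0:ℝ) 1 := smoothstep₂_mem_Icc _

/-- Below the window the range-9/2 tail weight vanishes: `w₄₅ r = 0` for `r ≤ 3`. [folklore] -/
theorem w₄₅_eq_zero {r : ℝ} (h : r ≤ 3) : w₄₅ r = 0 := by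
  have hx : (r - 3) / (9 / 2 - 3) ≤ 0 := div_nonpos_of_nonpos_of_nonneg (by linarith) (by norm_num)
  simp [w₄₅, cutWeight, smoothstep₁, hx]

/-! ## §2. The Lennard-Jones tail bound -/

/-- **`−(V·w)(r) ≤ r⁻⁶/6`** for `0 ≤ w(r) ≤ 1`, `r > 0` (tree normalisation `V(r) = r⁻¹²/12 − r⁻⁶/6`). [folklore] -/
theorem neg_tailPot_le {w : ℝ → ℝ} {r : ℝ} (hw : w r ∈ Icc (0:ℝ) 1) (hr : 0 < r) : -(tailPot w r) ≤ (r⁻¹) ^ 6 / 6 := by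
  unfold tailPot lennardJones
  set y : ℝ := (r⁻¹) ^ 6 with hy
  have hy0 : 0 ≤ y := by positivity
  have h12 : (r⁻¹) ^ 12 = y ^ 2 := by rw [hy]; ring
  rw [h12]
  obtain ⟨h0, h1⟩ := hw
  nlinarith [mul_nonneg hy0 (sub_nonneg.2 h1), mul_nonneg (sq_nonneg y) h0]

/-! ## §3. The certificate functional is nonnegative -/

/-- For `κ ≥ 0` the radial certificate functional is `≥ 0` at every `r > 0`. [folklore] -/
theorem radialCert_nonneg {a : ℝ} (ha : 0 < a) (κ : ℝ → ℝ) (hκ0 : ∀ s, 0 ≤ κ s) {r : ℝ} (hr : 0 < r) :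
    0 ≤ a ^ 3 * (512 * π / 3465) * (2 * π / r * ∫ s in Ioi 0, s * κ s * ∫ τ in |r - s|..(r + s), τ * omega₂ (τ / a)) := by
  refine mul_nonneg (by positivity) (mul_nonneg (by positivity) (setIntegral_nonneg measurableSet_Ioi fun s hs => ?_))
  have hs : 0 < s := hs
  refine mul_nonneg (mul_nonneg hs.le (hκ0 s))
    (intervalIntegral.integral_nonneg (by rw [abs_le]; constructor <;> linarith) fun τ hτ => ?_)
  have hτ0 : 0 ≤ τ := (abs_nonneg _).trans hτ.1
  exact mul_nonneg hτ0 (omega₂_nonneg (div_nonneg hτ0 ha.le))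

/-! ## §4. Convexity of the pure-power tail -/

/-- `s ↦ s·κ(s)` is convex on `[s₀, ∞)` when `κ(s) = c·s⁻⁶` there (`c ≥ 0`, `s₀ > 0`): it is `c·s⁻⁵`. [folklore] -/
theorem convexOn_tail {c s₀ : ℝ} (hc : 0 ≤ c) (hs₀ : 0 < s₀) (κ : ℝ → ℝ) (htail : ∀ s, s₀ ≤ s → κ s = c * (s⁻¹) ^ 6) :
    ConvexOn ℝ (Ici s₀) (fun s => s * κ s) := by
  have h1 : ConvexOn ℝ (Ici s₀) (fun s : ℝ => c • s ^ (-5 : ℤ)) :=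
    ((convexOn_zpow (-5 : ℤ)).subset (fun s hs => lt_of_lt_of_le hs₀ hs) (convex_Ici _)).smul hc
  refine h1.congr fun s hs => ?_
  have hs' : 0 < s := hs₀.trans_le hs
  simp only [smul_eq_mul]
  rw [htail s hs, zpow_neg, zpow_ofNat]
  field_simp

/-! ## §5. `SF₄₅` and `SF₅` from a near-field certificate alone -/

/-- ★★ **`SF₄₅` FROM A NEAR-FIELD CERTIFICATE** (`a = 4/5`, `A = 3/400`, `w = w₄₅`, tail constant `M = (32π(4/5)³/105)²`): a continuous
`κ ≥ 0` with `s²κ` integrable on `(0, ∞)`, equal to `s⁻⁶/(6M)` on `[R₁ − 8/5, ∞)` for some `R₁ > 8/5`, satisfying the one-variable domination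
inequality for `3 < r ≤ R₁` ONLY, and the budget `4π(∫_{s>0} s²κ)·(4/5)³·256π/3465 ≤ 3/400`, proves `SF₄₅`. [folklore chaining] -/
theorem sf₄₅_of_nearCert (κ : ℝ → ℝ) (hκc : Continuous κ) (hκ0 : ∀ s, 0 ≤ κ s) (hκi : IntegrableOn (fun s => s ^ 2 * κ s) (Ioi 0))
    (R₁ : ℝ) (hR₁ : 8 / 5 < R₁)
    (htail : ∀ s, R₁ - 8 / 5 ≤ s → κ s = (6 * (32 * π * (4 / 5 : ℝ) ^ 3 / 105) ^ 2)⁻¹ * (s⁻¹) ^ 6)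
    (hnear : ∀ r, 3 < r → r ≤ R₁ → -(tailPot w₄₅ r) ≤
      (4 / 5 : ℝ) ^ 3 * (512 * π / 3465) * (2 * π / r * ∫ s in Ioi 0, s * κ s * ∫ τ in |r - s|..(r + s), τ * omega₂ (τ / (4 / 5))))
    (hA : 4 * π * (∫ s in Ioi 0, s ^ 2 * κ s) * ((4 / 5 : ℝ) ^ 3 * (256 * π / 3465)) ≤ 3 / 400) : SF₄₅ := by
  have hM : 0 < (32 * π * (4 / 5 : ℝ) ^ 3 / 105) ^ 2 := by positivity
  refine sf₄₅_of_radialCert_finite κ hκc hκ0 hκi R₁ hR₁ (fun r hr hle => ?_) (fun r hr => ?_) ?_ hA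
  · rcases le_or_gt r 3 with h3 | h3
    · have h0 : tailPot w₄₅ r = 0 := by simp [tailPot, w₄₅_eq_zero h3]
      rw [h0, neg_zero]
      exact radialCert_nonneg (by norm_num) κ hκ0 hr
    · exact hnear r h3 hle
  · have hr0 : 0 < r := by linarith
    refine (neg_tailPot_le (w₄₅_mem_Icc r) hr0).trans (le_of_eq ?_)
    rw [htail r (by linarith)]
    field_simp
  · exact convexOn_tail (by positivity) (by linarith) κ htail

/-- ★ **`SF₅` FROM A NEAR-FIELD CERTIFICATE** (`a = 1`, `A = 13/4000`, `w = w₅`, tail constant `M = (32π/105)²`, tail from `R₁ − 2`,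
`R₁ > 2`; near field `3 < r ≤ R₁`). [folklore chaining] -/
theorem sf₅_of_nearCert (κ : ℝ → ℝ) (hκc : Continuous κ) (hκ0 : ∀ s, 0 ≤ κ s) (hκi : IntegrableOn (fun s => s ^ 2 * κ s) (Ioi 0))
    (R₁ : ℝ) (hR₁ : 2 < R₁)
    (htail : ∀ s, R₁ - 2 ≤ s → κ s = (6 * (32 * π / 105) ^ 2)⁻¹ * (s⁻¹) ^ 6)
    (hnear : ∀ r, 3 < r → r ≤ R₁ → -(tailPot w₅ r) ≤
      512 * π / 3465 * (2 * π / r * ∫ s in Ioi 0, s * κ s * ∫ τ in |r - s|..(r + s), τ * omega₂ τ))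
    (hA : 4 * π * (∫ s in Ioi 0, s ^ 2 * κ s) * (256 * π / 3465) ≤ 13 / 4000) : SF₅ := by
  have hM : 0 < (32 * π / 105) ^ 2 := by positivity
  refine sf₅_of_radialCert_finite κ hκc hκ0 hκi R₁ hR₁ (fun r hr hle => ?_) (fun r hr => ?_) ?_ hA
  · rcases le_or_gt r 3 with h3 | h3
    · have h0 : tailPot w₅ r = 0 := by simp [tailPot, w₅_eq_zero h3]
      rw [h0, neg_zero]
      have := radialCert_nonneg one_pos κ hκ0 hr
      simpa using this
    · exact hnear r h3 hle
  · have hr0 : 0 < r := by linarith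
    refine (neg_tailPot_le (w₅_mem_Icc r) hr0).trans (le_of_eq ?_)
    rw [htail r (by linarith)]
    field_simp
  · exact convexOn_tail (by positivity) (by linarith) κ htail

end Summit.AtomisticToContinuum.Crystallization.Theorems.FrustratedLawDichotomyBumpAutocorrelation

end
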